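import Literature.NumberTheory.Automorphic.ArchGroupGLCartan
import Literature.NumberTheory.Automorphic.AdelicGLnGlueProofs
import Literature.NumberTheory.Automorphic.HarishChandraConvolutionGL
import Literature.NumberTheory.Automorphic.HaarConjCompact
import Literature.NumberTheory.Automorphic.GLnGelfandKazhdanInvolution
import Mathlib.MeasureTheory.Group.ModularCharacter
import Mathlib.MeasureTheory.Measure.Haar.Unique
import HarnessLib

/-!
# `GL_n(K_∞)` is unimodular

Topic `NumberTheory/Automorphic`; namespace `Literature.NumberTheory.Automorphic`.

For a number field `K` the archimedean group `G_∞ = GL_n(K_∞) = GL_n(ℝ)^{r₁} × GL_n(ℂ)^{r₂}`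
(`GL (Fin n) (mixedSpace K)`) is unimodular: its modular character is trivial
(`modularCharacter_eq_one_glInf`) and every Haar measure on it is right invariant
(`isMulRightInvariant_of_isHaarMeasure_glInf`, for any Borel structure and Haar measure — in
particular the tree's `archHaar n K` under the local instances `glInfBorel`, `borelSpace_glInf`). Proof (Knapp (2002), VIII.§2, Cor. 8.31: reductive Lie groups are
unimodular; here by the elementary polar-decomposition argument): by the global Cartan
decomposition `G_∞ = K_∞ · exp 𝔭` (`hasCartanDecomposition_archGroupGL`) it suffices to see
`Δ(k) = 1` for `k` in the compact group `K_∞` (`modularCharacter_eq_one_of_mem_isCompact`) and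
`Δ(exp X) = 1` for `X` hermitian; for the latter, the modular character is invariant under the
continuous automorphism `θ(g) = (g*)⁻¹` of `G_∞` (transport of Haar measure,
`modularCharacter_continuousMulEquiv` of `GLnGelfandKazhdanInvolution`, the same lemma that gives the
`p`-adic unimodularity there), and `θ(exp X) = (exp X*)⁻¹ = (exp X)⁻¹`, so
`Δ(exp X)⁻¹ = Δ(exp X)`, i.e. `Δ(exp X) = 1`.

This is the ingredient that makes right translations act on the smoothing operators
`τ(α) = ∫ α(h) τ(h) dh` of `ArchGardingWhittaker` without a modular factor
(`τ(α) τ(g)⁻¹ = τ(α(· g))`), as needed for the `G_∞`-covariance of Whittaker distribution vectors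
in the archimedean uniqueness argument (Shalika (1974), §3).

Everything is proved; no definition and no named fact is introduced.

## References

* A. W. Knapp, *Lie Groups Beyond an Introduction*, 2nd ed. (2002), VIII.§2, Cor. 8.31 and
  I.§1, Prop. 1.2 (polar decomposition) [Knapp2002].
* A. Borel, H. Jacquet, *Automorphic forms and automorphic representations*, Corvallis (1979), §1.1
  [BorelJacquet1979].
* N. Bourbaki, *Intégration*, Ch. VII, §2, no. 7 (modular function and automorphisms).
-/

noncomputable section

open MeasureTheory Measure NumberField NumberField.mixedEmbedding Topology
open scoped MatrixGroups NNReal ENNReal Classical Matrix.Norms.Operator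

namespace Literature.NumberTheory.Automorphic

/-! ### 1. A positive character with `Δ(g⁻¹) = Δ(g)` is trivial at `g` -/

section ModularCharacter

variable {G : Type*} [Group G] [TopologicalSpace G] [IsTopologicalGroup G] [LocallyCompactSpace G]

/-- If `Δ(g⁻¹) = Δ(g)` then `Δ(g) = 1` (`Δ` is a positive real character). [folklore] -/
theorem modularCharacter_eq_one_of_map_inv_eq {g : G}
    (h : modularCharacter g⁻¹ = modularCharacter g) : modularCharacter g = 1 := by
  rw [map_inv] at h
  have hpos : 0 < modularCharacter g := modularCharacterFun_pos _
  have hsq : modularCharacter g * modularCharacter g = 1 := by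
    nth_rewrite 1 [← h]
    exact inv_mul_cancel₀ hpos.ne'
  have hsq' : (modularCharacter g : ℝ) * modularCharacter g = 1 := by exact_mod_cast hsq
  have hpos' : (0 : ℝ) < modularCharacter g := by exact_mod_cast hpos
  have h1 : (modularCharacter g : ℝ) = 1 := by nlinarith
  exact_mod_cast h1

end ModularCharacter

/-! ### 2. The automorphism `θ(g) = (g*)⁻¹` of `GL_n(K_∞)` and unimodularity -/

section GLInf

variable (n : ℕ) (K : Type) [Field K] [NumberField K]

omit [NumberField K] in
/-- `star` is continuous on `GL_n(K_∞)` (for the units topology): both `g ↦ (g*)` and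
`g ↦ (g*)⁻¹ = (g⁻¹)*` are continuous into matrices. [folklore] -/
theorem continuous_star_glInf : Continuous (star : GL (Fin n) (mixedSpace K) → GL (Fin n) (mixedSpace K)) := by
  refine Units.continuous_iff.2 ⟨?_, ?_⟩
  · have h : (Units.val ∘ star : GL (Fin n) (mixedSpace K) → Matrix (Fin n) (Fin n) (mixedSpace K)) =
        fun u => star ((u : GL (Fin n) (mixedSpace K)) : Matrix (Fin n) (Fin n) (mixedSpace K)) :=
      funext fun u => Units.coe_star u
    change Continuous (Units.val ∘ star : GL (Fin n) (mixedSpace K) → Matrix (Fin n) (Fin n) (mixedSpace K))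
    rw [h]
    exact continuous_star.comp Units.continuous_val
  · have h : (fun u : GL (Fin n) (mixedSpace K) => (((star u)⁻¹ : GL (Fin n) (mixedSpace K)) :
        Matrix (Fin n) (Fin n) (mixedSpace K))) =
        fun u => star (((u⁻¹ : GL (Fin n) (mixedSpace K)) : Matrix (Fin n) (Fin n) (mixedSpace K))) :=
      funext fun u => Units.coe_star_inv u
    change Continuous (fun u : GL (Fin n) (mixedSpace K) => (((star u)⁻¹ : GL (Fin n) (mixedSpace K)) :
        Matrix (Fin n) (Fin n) (mixedSpace K)))
    rw [h]
    exact continuous_star.comp Units.continuous_coe_inv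

/-- **The modular character of `GL_n(K_∞)` is trivial.** Cartan decomposition `g = k exp X`
(`k ∈ K_∞` compact, `X` hermitian): `Δ(k) = 1` on the compact subgroup `K_∞`, and
`Δ(exp X) = 1` because `Δ` is invariant under the automorphism `θ(g) = (g*)⁻¹` while
`θ(exp X) = (exp X)⁻¹`. [cite: Knapp2002, Cor. 8.31] -/
theorem modularCharacter_eq_one_glInf [LocallyCompactSpace (GL (Fin n) (mixedSpace K))]
    (g : GL (Fin n) (mixedSpace K)) : modularCharacter g = 1 := by
  borelize (GL (Fin n) (mixedSpace K))
  -- the continuous automorphism `θ(g) = (g*)⁻¹ = (g⁻¹)*`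
  let θ : GL (Fin n) (mixedSpace K) ≃ₜ* GL (Fin n) (mixedSpace K) :=
    { toFun := fun g => star g⁻¹
      invFun := fun g => star g⁻¹
      left_inv := fun g => by simp only [star_inv, inv_inv, star_star]
      right_inv := fun g => by simp only [star_inv, inv_inv, star_star]
      map_mul' := fun g h => by simp only [mul_inv_rev, star_mul]
      continuous_toFun := (continuous_star_glInf n K).comp continuous_inv
      continuous_invFun := (continuous_star_glInf n K).comp continuous_inv }
  have hθ : ∀ g, θ g = star g⁻¹ := fun g => rfl
  -- Cartan decomposition `g = k * exp X`
  obtain ⟨k, hk, X, -, hX, rfl⟩ := hasCartanDecomposition_archGroupGL n K g (Subgroup.mem_top g)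
  have hk1 : modularCharacter k = 1 :=
    modularCharacter_eq_one_of_mem_isCompact (isCompact_Kinf_holds n K) hk
  -- `θ(exp X) = (exp X)⁻¹` for hermitian `X`
  have hstar : star (expGL X) = expGL X := by
    refine Units.ext ?_
    rw [Units.coe_star, coe_expGL, Matrix.star_eq_conjTranspose, ← Matrix.exp_conjTranspose,
      ← Matrix.star_eq_conjTranspose, hX.star_eq]
  have hexp : modularCharacter (expGL X) = 1 := by
    refine modularCharacter_eq_one_of_map_inv_eq ?_
    have h := modularCharacter_continuousMulEquiv θ (expGL X)
    rwa [hθ, star_inv, hstar] at h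
  rw [map_mul, hk1, hexp, one_mul]

/-- **`GL_n(K_∞)` is unimodular**: every Haar measure on it is right invariant (Knapp (2002),
Cor. 8.31). [cite: Knapp2002, Cor. 8.31] -/
theorem isMulRightInvariant_of_isHaarMeasure_glInf [MeasurableSpace (GL (Fin n) (mixedSpace K))]
    [BorelSpace (GL (Fin n) (mixedSpace K))] (μ : Measure (GL (Fin n) (mixedSpace K)))
    [IsHaarMeasure μ] : μ.IsMulRightInvariant := by
  haveI := locallyCompactSpace_glInf n K
  haveI := secondCountableTopology_glInf n K
  haveI : μ.InnerRegularCompactLTTop := inferInstance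
  haveI : SigmaFinite μ := inferInstance
  haveI : μ.InnerRegular := inferInstance
  refine ⟨fun g => ?_⟩
  rw [map_right_mul_eq_modularCharacterFun_smul μ g]
  change (modularCharacter g) • μ = μ
  rw [modularCharacter_eq_one_glInf, one_smul]

/-- **Right translation of Haar integrals on `GL_n(K_∞)`**: `∫ f(h g) dh = ∫ f(h) dh`. [folklore] -/
theorem integral_mul_right_eq_self_glInf {E : Type*} [NormedAddCommGroup E] [NormedSpace ℝ E]
    [MeasurableSpace (GL (Fin n) (mixedSpace K))] [BorelSpace (GL (Fin n) (mixedSpace K))]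
    (μ : Measure (GL (Fin n) (mixedSpace K))) [IsHaarMeasure μ]
    (f : GL (Fin n) (mixedSpace K) → E) (g : GL (Fin n) (mixedSpace K)) :
    ∫ h, f (h * g) ∂μ = ∫ h, f h ∂μ := by
  haveI := isMulRightInvariant_of_isHaarMeasure_glInf n K μ
  exact integral_mul_right_eq_self f g

end GLInf

end Literature.NumberTheory.Automorphic
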